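import Mathlib
import HarnessLib
import Literature.MathematicalPhysics.StatisticalMechanics.StrongWeightBlocks
import Literature.MathematicalPhysics.StatisticalMechanics.WeightStrongStepABKM
import Literature.MathematicalPhysics.StatisticalMechanics.LinearisedMapABKM

/-!
# The weight inequality behind Lemma 8.3 (iii) / the `P₁` estimate of [ABKM19] for the torus tower:
# `W_k^{Z} · W_k^{Z'} · w_{k:k+1}^{X₂} ≤ w_{k+1}^U` for `Z, Z' ⊆ U⁺`, `X₂ ⊆ U*`

[ABKM19] Lemma 8.3 (iii) bounds `‖F₁^{Z₁}F₂^{Z₂}F₃^{X}K(Y)‖_{k+1,π(X∪Y)}` by the product of the strong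
norms of the block functionals and `‖K(Y)‖_{k:k+1,Y}`; on the level of weights this is
`W_k^{Z₁∪Z₂} W_k^{X} w_{k:k+1}^Y ≤ (W_k^{U⁺})² w_{k:k+1}^Y ≤ w_{k+1}^U` (Theorem 7.1 (w5), (w6)).  We prove
this for the torus data (`abkmWeightData`, strong forms `G_k^X = g_k Σ_α L^{2k(|α|−1)}(∇^α)ᵀχ_k^X∇^α`,
`g_k = h_k^{−2}`): the admissibility `2^{d+1}g_kθ_max² ≤ δ'_{k+1}` of the doubled strong form follows
from `h² ≥ h₀(L)²`, the strong weights are monotone in the polymer, and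
`WeightStrongStepABKM.midWeight_mul_sq_le_weight_succ_abkm` is (w6).

* `two_pow_mul_strongCoef_le` — `2^{d+1}g_kθ_max² ≤ δ'_{k+1}` for `k + 1 ≤ N`, `h² ≥ h₀²`;
* `starRad_succ_le_plusRad` — `U* ⊆ U⁺` (`2^d + R ≤ L`);
* `expWeight_strong_mono` — `W_k^Z ≤ W_k^{Z'}` for `Z ⊆ Z'`;
* **`prod_strongWeight_sq_mul_midWeight_le_abkm`** —
  `(∏_{B∈𝓑_k(Z)} W_k^B)(∏_{B∈𝓑_k(Z')} W_k^B) · w_{k:k+1}^{X₂} ≤ w_{k+1}^U`.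

Everything is proved; no named fact.

## References
* S. Adams, S. Buchholz, R. Kotecký, S. Müller, arXiv:1910.13564, Lemma 8.3 (iii), Theorem 7.1 (w5)–(w6),
  (7.60)–(7.63) [AdamsBuchholzKoteckyMuller2019].
-/

noncomputable section

namespace Literature.MathematicalPhysics.StatisticalMechanics.GradientRG

open scoped BigOperators
open Finset Matrix
open Literature.MathematicalPhysics.StatisticalMechanics.TorusPolymer
  (IsPolymer blocks thicken thicken_mono thicken_mono_rad)

variable {d M : ℕ} [NeZero M]

/-- **Admissibility of the doubled strong form**: `2^{d+1} g_k θ_max² ≤ δ'_{k+1}` for `k + 1 ≤ N` when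
`h² ≥ h₀(L)²` ((7.60): `2^{d+3}θ_max² ≤ δ₁h²`, `g_k = 4^{−k}h^{−2}`, `δ'_{k+1} = δ₁4^{−(k+1)}`).
[cite: AdamsBuchholzKoteckyMuller2019, Theorem 7.1 (7.60)–(7.62)] -/
theorem two_pow_mul_strongCoef_le {R N k : ℕ} {δ₀ δ₁ h : ℝ} (hδ₀ : 0 < δ₀) (hδ₁ : 0 < δ₁) (hh : 0 < h)
    (hh0 : hZeroSq d R δ₀ δ₁ ≤ h ^ 2) (hk : k + 1 ≤ N) :
    (2 : ℝ) ^ (d + 1) * strongCoef h N k * thetaMax R d ^ 2 ≤ schedDelta δ₀ δ₁ N (k + 1) := by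
  obtain ⟨-, h2, -⟩ := of_hZeroSq_le hδ₀ hδ₁ hh0
  rw [schedDelta_succ, deltaSeq, if_pos ⟨by omega, hk⟩, strongCoef_of_le (by omega : k ≤ N), hScale_sq]
  have hden : (0 : ℝ) < 4 ^ k * h ^ 2 := by positivity
  have h4k1 : (0 : ℝ) < 4 ^ (k + 1) := by positivity
  rw [show (2 : ℝ) ^ (d + 1) * (4 ^ k * h ^ 2)⁻¹ * thetaMax R d ^ 2 =
      (2 ^ (d + 1) * thetaMax R d ^ 2) / (4 ^ k * h ^ 2) by field_simp,
    div_le_div_iff₀ hden h4k1]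
  have h23 : (2 : ℝ) ^ (d + 3) = 2 ^ (d + 1) * 4 := by
    rw [show d + 3 = (d + 1) + 2 by omega, pow_add]; norm_num
  calc (2 : ℝ) ^ (d + 1) * thetaMax R d ^ 2 * 4 ^ (k + 1)
      = (2 ^ (d + 3) * thetaMax R d ^ 2) * 4 ^ k := by rw [h23, pow_succ]; ring
    _ ≤ (δ₁ * h ^ 2) * 4 ^ k := by gcongr
    _ = δ₁ * (4 ^ k * h ^ 2) := by ring

/-- **`U* ⊆ U⁺` at scales `≥ 1`**: `starRad_{k+1} ≤ plusRad_{k+1}` when `2^d + R ≤ L`.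
[cite: AdamsBuchholzKoteckyMuller2019, Ch. 6.2 (6.25)] -/
theorem starRad_succ_le_plusRad {R L : ℕ} (hL : 2 ^ d + R ≤ L) (k : ℕ) :
    starRad R L d (k + 1) ≤ plusRad R L (k + 1) := by
  cases k with
  | zero => simpa [starRad, plusRad] using hL
  | succ k =>
    simp only [starRad, plusRad]
    rw [pow_succ' L (k + 1)]
    exact Nat.mul_le_mul_right _ (le_trans (Nat.le_add_right _ _) hL)

/-- **The strong weights are monotone in the polymer**: `W_k^Z ≤ W_k^{Z'}` for `Z ⊆ Z'` (`g ≥ 0`, `L ≥ 0`,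
`w ≥ 0`). [cite: AdamsBuchholzKoteckyMuller2019, Theorem 7.1 (w5)] -/
theorem expWeight_strong_mono {L g w : ℝ} (hL : 0 ≤ L) (hg : 0 ≤ g) (hw : 0 ≤ w) (k ρ : ℕ)
    (s : Finset (Fin d → ℕ)) {Z Z' : Finset (Fin d → ZMod M)} (hZ : Z ⊆ Z') (φ : (Fin d → ZMod M) → ℝ) :
    expWeight (g • derivForm L k s (boxDensity ρ w Z)) φ ≤ expWeight (g • derivForm L k s (boxDensity ρ w Z')) φ := by
  refine expWeight_mono ?_ φ
  rw [← smul_sub]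
  exact (derivForm_mono hL k s fun x => boxDensity_mono ρ hw hZ x).smul hg

/-- **Lemma 8.3 (iii) on the level of weights, for the torus tower.**  Let `L` be odd with
`L ≥ 2^{d+3} + 16R`, `R ≥ 2`, `M = L^N`, `k + 1 ≤ N`, `h² ≥ h₀²` (`δ₀, δ₁, h > 0`), the tower dominated
and monotone (`AbkmWeightBounds`).  For a `(k+1)`-polymer `U`, `X₂ ⊆ U*` and `k`-polymers
`Z, Z' ⊆ U⁺`:
`(∏_{B ∈ 𝓑_k(Z)} W_k^B(φ)) (∏_{B ∈ 𝓑_k(Z')} W_k^B(φ)) w_{k:k+1}^{X₂}(φ) ≤ w_{k+1}^U(φ)`.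
[cite: AdamsBuchholzKoteckyMuller2019, Lemma 8.3 (iii)] -/
theorem prod_strongWeight_sq_mul_midWeight_le_abkm {L N Mord R n : ℕ} {θbar lam μ δ₁ δ₀ A𝒫 h : ℝ}
    {𝒞 : ℕ → (Fin d → ZMod M) → ℝ}
    (hB : AbkmWeightBounds L N Mord R n θbar lam μ δ₁ δ₀ A𝒫 𝒞
      (abkmWeightData L N Mord R θbar (schedDelta δ₀ δ₁ N) 𝒞))
    (hLodd : Odd L) (hL : 2 ^ (d + 3) + 16 * R ≤ L) (hR : 2 ≤ R) (hM : M = L ^ N) {k : ℕ}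
    (hk : k + 1 ≤ N) (hδ₀ : 0 < δ₀) (hδ₁ : 0 < δ₁) (hh : 0 < h) (hh0 : hZeroSq d R δ₀ δ₁ ≤ h ^ 2)
    {U X₂ Z Z' : Finset (Fin d → ZMod M)} (hU : IsPolymer (L ^ (k + 1)) U)
    (hXU : X₂ ⊆ thicken (starRad R L d (k + 1)) U) (hZ : IsPolymer (L ^ k) Z)
    (hZU : Z ⊆ thicken (plusRad R L (k + 1)) U) (hZ' : IsPolymer (L ^ k) Z')
    (hZ'U : Z' ⊆ thicken (plusRad R L (k + 1)) U) (φ : (Fin d → ZMod M) → ℝ) :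
    (∏ B ∈ blocks (L ^ k) Z, expWeight (strongCoef h N k • derivForm (L : ℝ) k (diffIndex d Mord)
        (boxDensity (boxRad R L k) (boxWt (L : ℝ) d k) B)) φ) *
      (∏ B ∈ blocks (L ^ k) Z', expWeight (strongCoef h N k • derivForm (L : ℝ) k (diffIndex d Mord)
        (boxDensity (boxRad R L k) (boxWt (L : ℝ) d k) B)) φ) *
      (abkmWeightData L N Mord R θbar (schedDelta δ₀ δ₁ N) 𝒞).midWeight k X₂ φ ≤
      (abkmWeightData L N Mord R θbar (schedDelta δ₀ δ₁ N) 𝒞).weight (k + 1) U φ := by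
  set W := abkmWeightData L N Mord R θbar (schedDelta δ₀ δ₁ N) 𝒞 with hW
  set G : ℕ → Finset (Fin d → ZMod M) → Matrix (Fin d → ZMod M) (Fin d → ZMod M) ℝ :=
    fun j Y => strongCoef h N j • derivForm (L : ℝ) j (diffIndex d Mord)
      (boxDensity (boxRad R L j) (boxWt (L : ℝ) d j) Y) with hG
  have hGs : W.StrongDominated G fun _ X Y => Disjoint X Y :=
    hB.strong (diffIndex d Mord) (fun α hα => hα) (strongCoef h N) (strongCoef_le hδ₀ hδ₁ hh hh0)
  have hL0 : (0 : ℝ) ≤ L := Nat.cast_nonneg L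
  have hg : 0 ≤ strongCoef h N k := strongCoef_nonneg h N k
  have hw : 0 ≤ boxWt (L : ℝ) d k := by unfold boxWt; positivity
  set Up := thicken (plusRad R L (k + 1)) U with hUp
  have h1 : ∏ B ∈ blocks (L ^ k) Z, expWeight (G k B) φ ≤ expWeight (G k Up) φ := by
    rw [prod_expWeight_blocks hGs k (L ^ k) hZ φ]
    exact expWeight_strong_mono hL0 hg hw k _ _ hZU φ
  have h2 : ∏ B ∈ blocks (L ^ k) Z', expWeight (G k B) φ ≤ expWeight (G k Up) φ := by
    rw [prod_expWeight_blocks hGs k (L ^ k) hZ' φ]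
    exact expWeight_strong_mono hL0 hg hw k _ _ hZ'U φ
  have hexp0 : ∀ A : Matrix (Fin d → ZMod M) (Fin d → ZMod M) ℝ, 0 ≤ expWeight A φ := fun A => by
    unfold expWeight; exact (Real.exp_pos _).le
  have hp2 : 0 ≤ ∏ B ∈ blocks (L ^ k) Z', expWeight (G k B) φ :=
    Finset.prod_nonneg fun B _ => hexp0 _
  have hmid : 0 ≤ W.midWeight k X₂ φ := (W.midWeight_pos k X₂ φ).le
  have hgδ : 2 ^ (d + 1) * strongCoef h N k * thetaMax R d ^ 2 ≤ schedDelta δ₀ δ₁ N (k + 1) :=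
    two_pow_mul_strongCoef_le hδ₀ hδ₁ hh hh0 hk
  have hw6 := midWeight_mul_sq_le_weight_succ_abkm hLodd hL hR hM hk hB.dominated hB.monotone
    (subset_refl (diffIndex d Mord)) hg hgδ hU hXU φ
  have h12 : (∏ B ∈ blocks (L ^ k) Z, expWeight (G k B) φ) * (∏ B ∈ blocks (L ^ k) Z', expWeight (G k B) φ)
      ≤ expWeight (G k Up) φ * expWeight (G k Up) φ := mul_le_mul h1 h2 hp2 (hexp0 _)
  calc (∏ B ∈ blocks (L ^ k) Z, expWeight (G k B) φ) * (∏ B ∈ blocks (L ^ k) Z', expWeight (G k B) φ) *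
        W.midWeight k X₂ φ
      ≤ expWeight (G k Up) φ * expWeight (G k Up) φ * W.midWeight k X₂ φ :=
        mul_le_mul_of_nonneg_right h12 hmid
    _ = W.midWeight k X₂ φ * expWeight (G k Up) φ ^ 2 := by ring
    _ ≤ W.weight (k + 1) U φ := hw6

end Literature.MathematicalPhysics.StatisticalMechanics.GradientRG

end
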